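import Mathlib.Topology.Algebra.Category.ProfiniteGrp.Basic
import Mathlib.Topology.Instances.ZMod
import Literature.AnabelianGeometry.AbsoluteAnabelian.AbsTopII.InertiaGroupsScope

/-!
# [AbsTopII] Prop 1.3 (viii), (x) in the PRINTED conjugacy scope (v2: `Prop_1_3_viii'`,
# `Prop_1_3_x'`): universal closures of the schemata — kernel verdicts (rows F-3903, F-3904)

S. Mochizuki, *Topics in Absolute Anabelian Geometry II* [AbsTopII] (bib `MochizukiAbsTopII2013`;
locators = PDF pages of the kurims manuscript `paper:url-585b8d0ad0d9`), §1, Proposition 1.3 (viii),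
(x) p. 12; Def 1.2 (ii) p. 10 (conjugates "in `Π_𝔾`").  PROOF-ONLY companion of
`AbsTopII/InertiaGroupsScope.lean` (abc-iut cell, seat abc-iut-f-070; sequel of
`InertiaGroupsSchemaClosures.lean`, F-0300/F-0301); no notion is declared, nothing is restated.

abc-iut-L4-t6's v2 statements `DPSCIndexData.Prop_1_3_viii'`, `DPSCIndexData.Prop_1_3_x'` repair the
conjugacy scope of the v1 typings (`γ ∈ Π_𝔾` instead of `Π_H`; finding F-L4t6g5-1) and are the decls
consumers are told to use ("SUPERSEDED for consumers by `Prop_1_3_x'`").  They remain PREDICATES on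
abstract DPSC index data; this file records, for the C-certificates, that their universal closures
are NOT theorems either (so neither may be bound as a closed `∀`-hypothesis), and that both are
satisfiable:

* `not_forall_prop_1_3_x'` (F-3904) — the v1 witness of `not_forall_prop_1_3_x` survives the scope
  repair verbatim: the label `LogPointData.kind` is free; over `Π_H = 1` (`Π_𝔾 = 1`, two vertices
  `false ≠ true`, `Π_v = 1`, no edges) a log point labelled "smooth point of `true`" violates
  "`τ_I(I) = γ·I_{false}·γ⁻¹` for some `γ ∈ Π_𝔾` iff the image is a non-nodal point of `false`"
  (left side true with `γ = 1`, right side false).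
* `not_forall_prop_1_3_viii'` (F-3903) — over `Π_H = ℤ/2` (discrete) with `Π_𝔾 = Π_I = Π_H`, one
  vertex `v` with `Π_v = Π_H` and two cusps `e ≠ e'` at `v` with `Π_e = Π_{e'} = 1`: `D_e = D_{e'} =
  N(1) = Π_H`, so `D_e ∩ D_{e'} ∩ Π_I = Π_H ≠ 1` (with `γ = 1 ∈ Π_𝔾`), while property (1) `e = e'`
  fails and property (2) demands `D_e ∩ D_{e'} ∩ Π_𝔾 = 1`, i.e. `Π_H = 1` — false. (The excluded
  data violate [CombGC] Prop 1.2 (ii): here `Π_e = 1` is not commensurably terminal in `Π_𝔾 = ℤ/2`.)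
* `exists_prop_1_3_x'`, `exists_prop_1_3_viii'` — both schemata are satisfiable over `Π_H = 1`
  (for (viii)′ the premise `… ≠ 1` is never met), so each row is a genuine hypothesis on the data.

HONEST FRAMING: statements about the cell's own typings over abstract data; the printed Prop 1.3
concerns the data of a stable log curve and is neither refuted nor proved here; nothing here bears
on [IUTchIII] Cor 3.12 or takes a side; typed ≠ proved.
-/

open scoped Pointwise

namespace Literature.AnabelianGeometry.AbsoluteAnabelian.AbsTopII.DPSCIndexData

/-! ## F-3904: Prop 1.3 (x), printed scope (`Prop_1_3_x'`) -/

/-- **F-3904, universal closure REFUTED.** `DPSCIndexData.Prop_1_3_x'` does NOT hold for all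
abstract DPSC index data (same witness as for the v1 row F-0301: `LogPointData.kind` is a free
label; `Π_H = 1`, vertices `false ≠ true`, log point `τ_I(I) = Π_I` labelled "smooth point of
`true`", `γ = 1 ∈ Π_𝔾`). [cite: MochizukiAbsTopII2013, Prop 1.3 (x) p.12] -/
theorem not_forall_prop_1_3_x' :
    ¬ ∀ X : DPSCIndexData.{0},
      Literature.AnabelianGeometry.AbsoluteAnabelian.AbsTopII.DPSCIndexData.Prop_1_3_x' X := by
  intro h
  let P : ProfiniteGrp.{0} := ProfiniteGrp.of PUnit.{1}
  let X : DPSCIndexData.{0} :=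
    { PiH := P, PiG := ⊥, normal_PiG := inferInstance, isClosed_PiG := isClosed_discrete _,
      PiI := ⊤, PiG_le_PiI := bot_le, normal_PiI := ⟨fun _ _ _ => Subgroup.mem_top _⟩,
      Vert := Bool, Node := PEmpty, Cusp := PEmpty,
      vertSub := fun _ => ⊥, vertSub_le := fun _ => le_rfl,
      nodeSub := fun e => e.elim, nodeSub_le := fun e => e.elim,
      cuspSub := fun e => e.elim, cuspSub_le := fun e => e.elim,
      nodeAbuts := fun e _ => e.elim, cuspVert := fun e => e.elim,
      Sigma := {2},
      sigma_prime := ⟨Set.singleton_nonempty 2, fun p hp => by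
        rw [Set.mem_singleton_iff.mp hp]; exact Nat.prime_two⟩,
      sigmaIndex := fun e => e.elim, sigmaIndex_isSigmaInteger := fun e => e.elim }
  haveI hP : Subsingleton X.PiH := inferInstanceAs (Subsingleton PUnit.{1})
  let τ : X.LogPointData :=
    { image := ⊤, image_le := le_rfl, isClosed_image := isClosed_discrete _,
      image_inf := Subsingleton.elim _ _, image_sup := Subsingleton.elim _ _,
      kind := PointKind.smooth true }
  obtain ⟨-, h2⟩ := h X τ
  have key := ((h2 fun e => e.elim).1 false).mp ⟨1, Subgroup.one_mem _, Subsingleton.elim _ _⟩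
  -- `key : PointKind.smooth true = PointKind.smooth false`
  cases key

/-- **F-3904, the schema is satisfiable** (`Π_H = 1`, ONE vertex, no edges).  Non-vacuity only.
[cite: MochizukiAbsTopII2013, Prop 1.3 (x) p.12] -/
theorem exists_prop_1_3_x' :
    ∃ X : DPSCIndexData.{0},
      Literature.AnabelianGeometry.AbsoluteAnabelian.AbsTopII.DPSCIndexData.Prop_1_3_x' X := by
  let P : ProfiniteGrp.{0} := ProfiniteGrp.of PUnit.{1}
  let X : DPSCIndexData.{0} :=
    { PiH := P, PiG := ⊥, normal_PiG := inferInstance, isClosed_PiG := isClosed_discrete _,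
      PiI := ⊤, PiG_le_PiI := bot_le, normal_PiI := ⟨fun _ _ _ => Subgroup.mem_top _⟩,
      Vert := PUnit, Node := PEmpty, Cusp := PEmpty,
      vertSub := fun _ => ⊥, vertSub_le := fun _ => le_rfl,
      nodeSub := fun e => e.elim, nodeSub_le := fun e => e.elim,
      cuspSub := fun e => e.elim, cuspSub_le := fun e => e.elim,
      nodeAbuts := fun e _ => e.elim, cuspVert := fun e => e.elim,
      Sigma := {2},
      sigma_prime := ⟨Set.singleton_nonempty 2, fun p hp => by
        rw [Set.mem_singleton_iff.mp hp]; exact Nat.prime_two⟩,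
      sigmaIndex := fun e => e.elim, sigmaIndex_isSigmaInteger := fun e => e.elim }
  haveI hP : Subsingleton X.PiH := inferInstanceAs (Subsingleton PUnit.{1})
  refine ⟨X, fun τ => ⟨fun hnv => ?_, fun _ => ⟨fun v => ?_, fun e => e.elim⟩⟩⟩
  · exact (hnv PUnit.unit 1 (le_of_eq (Subsingleton.elim _ _))).elim
  · obtain ⟨u⟩ := v
    refine ⟨fun _ => ?_, fun _ => ⟨1, Subgroup.one_mem _, Subsingleton.elim _ _⟩⟩
    rcases τ.kind with e | w | e
    · exact e.elim
    · rfl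
    · exact e.elim

/-! ## F-3903: Prop 1.3 (viii), printed scope (`Prop_1_3_viii'`) -/

/-- **F-3903, universal closure REFUTED.**  `DPSCIndexData.Prop_1_3_viii'` does NOT hold for all
abstract DPSC index data: over `Π_H = ℤ/2` (discrete), `Π_𝔾 = Π_I = Π_H`, one vertex with `Π_v =
Π_H` and two cusps `false ≠ true` at it with trivial cuspidal subgroups, one has `D_e = D_{e'} =
Π_H`, so with `γ = 1 ∈ Π_𝔾` the premise `D_e ∩ D_{e'} ∩ Π_I ≠ 1` holds, (1) fails (`e ≠ e'`), and
(2) would force `D_e ∩ D_{e'} ∩ Π_𝔾 = Π_H = 1`. The excluded data violate [CombGC] Prop 1.2 (ii)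
(`Π_e = 1` is not commensurably terminal in `Π_𝔾`), an input of the printed proof. [cite:
MochizukiAbsTopII2013, Prop 1.3 (viii) p.12] -/
theorem not_forall_prop_1_3_viii' :
    ¬ ∀ X : DPSCIndexData.{0},
      Literature.AnabelianGeometry.AbsoluteAnabelian.AbsTopII.DPSCIndexData.Prop_1_3_viii' X := by
  intro h
  let P : ProfiniteGrp.{0} := ProfiniteGrp.of (Multiplicative (ZMod 2))
  let X : DPSCIndexData.{0} :=
    { PiH := P, PiG := ⊤, normal_PiG := ⟨fun _ _ _ => Subgroup.mem_top _⟩,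
      isClosed_PiG := by rw [Subgroup.coe_top]; exact isClosed_univ,
      PiI := ⊤, PiG_le_PiI := le_rfl, normal_PiI := ⟨fun _ _ _ => Subgroup.mem_top _⟩,
      Vert := PUnit, Node := PEmpty, Cusp := Bool,
      vertSub := fun _ => ⊤, vertSub_le := fun _ => le_rfl,
      nodeSub := fun e => e.elim, nodeSub_le := fun e => e.elim,
      cuspSub := fun _ => ⊥, cuspSub_le := fun _ => bot_le,
      nodeAbuts := fun e _ => e.elim, cuspVert := fun _ => PUnit.unit,
      Sigma := {2},
      sigma_prime := ⟨Set.singleton_nonempty 2, fun p hp => by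
        rw [Set.mem_singleton_iff.mp hp]; exact Nat.prime_two⟩,
      sigmaIndex := fun e => e.elim, sigmaIndex_isSigmaInteger := fun e => e.elim }
  haveI : Nontrivial X.PiH := inferInstanceAs (Nontrivial (Multiplicative (ZMod 2)))
  -- `D_e = N(1) = Π_H` for both cusps
  have hD : ∀ b : Bool, X.DEdge (Sum.inr b) = ⊤ := fun b =>
    Subgroup.normalizer_eq_top (⊥ : Subgroup P)
  have h1 := h X (Sum.inr true) (Sum.inr false) 1 (Subgroup.mem_top _)
  rw [map_one, one_smul, hD, hD] at h1
  have htop : (⊤ : Subgroup X.PiH) ⊓ ⊤ ⊓ X.PiI = ⊤ := by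
    show (⊤ : Subgroup X.PiH) ⊓ ⊤ ⊓ ⊤ = ⊤
    rw [inf_idem, inf_idem]
  rw [htop] at h1
  -- (`X.PiG` is the same term `⊤`, so the (2)-conjunct is rewritten to `⊤ = ⊥` as well)
  rcases h1 top_ne_bot with h0 | ⟨-, v, -, -, h0, -⟩
  · exact Bool.noConfusion (Sum.inr_injective h0)
  · exact top_ne_bot h0

/-- **F-3903, the schema is satisfiable** (`Π_H = 1`: the premise `D_e ∩ γ·D_{e'}·γ⁻¹ ∩ Π_I ≠ 1` is
never met).  Non-vacuity only. [cite: MochizukiAbsTopII2013, Prop 1.3 (viii) p.12] -/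
theorem exists_prop_1_3_viii' :
    ∃ X : DPSCIndexData.{0},
      Literature.AnabelianGeometry.AbsoluteAnabelian.AbsTopII.DPSCIndexData.Prop_1_3_viii' X := by
  let P : ProfiniteGrp.{0} := ProfiniteGrp.of PUnit.{1}
  let X : DPSCIndexData.{0} :=
    { PiH := P, PiG := ⊥, normal_PiG := inferInstance, isClosed_PiG := isClosed_discrete _,
      PiI := ⊤, PiG_le_PiI := bot_le, normal_PiI := ⟨fun _ _ _ => Subgroup.mem_top _⟩,
      Vert := PUnit, Node := PEmpty, Cusp := PUnit,
      vertSub := fun _ => ⊥, vertSub_le := fun _ => le_rfl,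
      nodeSub := fun e => e.elim, nodeSub_le := fun e => e.elim,
      cuspSub := fun _ => ⊥, cuspSub_le := fun _ => le_rfl,
      nodeAbuts := fun e _ => e.elim, cuspVert := fun _ => PUnit.unit,
      Sigma := {2},
      sigma_prime := ⟨Set.singleton_nonempty 2, fun p hp => by
        rw [Set.mem_singleton_iff.mp hp]; exact Nat.prime_two⟩,
      sigmaIndex := fun e => e.elim, sigmaIndex_isSigmaInteger := fun e => e.elim }
  haveI hP : Subsingleton X.PiH := inferInstanceAs (Subsingleton PUnit.{1})
  haveI : Subsingleton (Subgroup X.PiH) := Unique.instSubsingleton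
  exact ⟨X, fun e e' γ _ hne => (hne (Subsingleton.elim _ _)).elim⟩

/-- **Kernel verdicts on the two v2 schema rows** F-3903 / F-3904: universal closures refuted,
schemata satisfiable — genuine hypotheses on the DPSC data, consumable only per instance. [cite:
MochizukiAbsTopII2013, Prop 1.3 (viii)/(x) p.12] -/
theorem prop_1_3_viii'_x'_schema_verdict :
    ((¬ ∀ X : DPSCIndexData.{0},
        Literature.AnabelianGeometry.AbsoluteAnabelian.AbsTopII.DPSCIndexData.Prop_1_3_viii' X) ∧
      ∃ X : DPSCIndexData.{0},
        Literature.AnabelianGeometry.AbsoluteAnabelian.AbsTopII.DPSCIndexData.Prop_1_3_viii' X) ∧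
    ((¬ ∀ X : DPSCIndexData.{0},
        Literature.AnabelianGeometry.AbsoluteAnabelian.AbsTopII.DPSCIndexData.Prop_1_3_x' X) ∧
      ∃ X : DPSCIndexData.{0},
        Literature.AnabelianGeometry.AbsoluteAnabelian.AbsTopII.DPSCIndexData.Prop_1_3_x' X) :=
  ⟨⟨not_forall_prop_1_3_viii', exists_prop_1_3_viii'⟩, ⟨not_forall_prop_1_3_x', exists_prop_1_3_x'⟩⟩

end Literature.AnabelianGeometry.AbsoluteAnabelian.AbsTopII.DPSCIndexData
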